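import Mathlib
import Summits.NavierStokesRegularity.NavierStokesRegularity.Theorems.TaoLadderRungTwoBreakOneShiftWindowStepPairSlope
import HarnessLib

/-!
# The one-shift window system, XVIII: TERM-LIST BILINEAR FIELDS — the x-Jacobian of a field given as a finite list
# of products `coef · (factor a) · (factor b)` whose factors are state coordinates or external values (the tails at
# the current time), with the explicit entry formula and its affine closeness modulus (cell harvest/h2-tao-ladder,
# seat p2; rung1/KERNEL-CHEAP-REPLAY-SPEC.md §1 (the 10-term list, 758 (site, term) pairs), §6 (iv), §7 (R1);
# support for K1(1) = `NoSurvivingDSSOne`, stmt-NavierStokesRegularity-20205)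

MODEL lattice ODEs only (Tao 2016 §4 normal form on Tao's shift set `S`); nothing here is a statement about
the Navier–Stokes equations; no item is closed; nothing numerical is proved. Generic in the state index `ι` and the
term index `κ`; this is the REAL side of the replay's data model (SPEC §1): the window field at time `t` with tails
`T` is such a term list (window partners = coordinates, tail partners = the external values `T_{i,k}(t)`), so the
hypotheses `hf`/`hfc`/`hdg`/`hR`/`hclose` of part XVI `exists_stepPairSlope` and `hδ` of part XVII become finite sums
over the list, to be enclosed by the checker (p1's `pqJacA` rows are the interval side of `jacEntry`).

* `Factor ι` (coordinate `coord c` or external value `ext e`), `Factor.val`, `Factor.deriv`;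
* `BTerm ι` = (out, coef, fa, fb); `termField T x i = Σ_k [out_k = i] coef_k · val fa_k x · val fb_k x`;
* `jacEntry T x i j = Σ_k [out_k = i] coef_k · ([fa_k = coord j] · val fb_k x + val fa_k x · [fb_k = coord j])`;
* `hasFDerivAt_termField` — `termField T` has at every `x` a derivative whose `(i, j)` entry is `jacEntry T x i j`
  (`termField_fderiv_entry`); hence `HasFDerivWithinAt` on any hull;
* `abs_jacEntry_sub_le` — for two term lists with the same skeleton (outputs, coefficients, coordinate pattern) but
  possibly different external values, `|jacEntry T x i j − jacEntry T' x' i j| ≤ Σ_k [out_k = i] |coef_k| ·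
  ([fa_k = coord j] · |val fb_k x − val fb'_k x'| + [fb_k = coord j] · |val fa_k x − val fa'_k x'|)` — the affine
  closeness `Bt + Σ L |x − x'|` of `StepSlopeData` once the external differences are bounded by tube radii.
-/

noncomputable section

-- the sub-problem namespace repeats the summit name by design (D-0017)
set_option linter.dupNamespace false

namespace Summit.NavierStokesRegularity.NavierStokesRegularity.Theorems

namespace DSSOneShift

open Set Metric

variable {ι : Type*} [Fintype ι] [DecidableEq ι] {κ : Type*} [Fintype κ]

/-- A factor of a bilinear term: a state coordinate or an external (time-frozen tail) value. [cite: Tao2016AveragedNS, §4 (4.8); cell vocabulary, harvest/h2-tao-ladder rung1/KERNEL-CHEAP-REPLAY-SPEC.md §1 (term list)] -/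
inductive Factor (ι : Type*) where
  /-- the state coordinate `c` -/
  | coord (c : ι) : Factor ι
  /-- an external value (a tail value at the current time) -/
  | ext (e : ℝ) : Factor ι

namespace Factor

/-- The value of a factor at the state `x`. [folklore] -/
def val (x : ι → ℝ) : Factor ι → ℝ
  | coord c => x c
  | ext e => e

/-- The derivative of a factor (a coordinate projection or zero). [folklore] -/
def deriv : Factor ι → ((ι → ℝ) →L[ℝ] ℝ)
  | coord c => ContinuousLinearMap.proj c
  | ext _ => 0

/-- The indicator «this factor is the coordinate `j`». [folklore] -/
def isCoord (j : ι) : Factor ι → ℝ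
  | coord c => if c = j then 1 else 0
  | ext _ => 0

omit [Fintype ι] [DecidableEq ι] in
/-- A factor has its declared derivative everywhere. [folklore] -/
theorem hasFDerivAt_val (φ : Factor ι) (x : ι → ℝ) : HasFDerivAt (fun y => φ.val y) φ.deriv x := by
  cases φ with
  | coord c => exact (ContinuousLinearMap.proj (R := ℝ) (φ := fun _ : ι => ℝ) c).hasFDerivAt
  | ext e => exact hasFDerivAt_const e x

omit [Fintype ι] in
/-- The derivative of a factor on a basis vector is the coordinate indicator. [folklore] -/
theorem deriv_single (φ : Factor ι) (j : ι) : φ.deriv (Pi.single j 1) = φ.isCoord j := by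
  cases φ with
  | coord c => simp [deriv, isCoord, Pi.single_apply]
  | ext e => simp [deriv, isCoord]

omit [Fintype ι] in
/-- `isCoord` is `0` or `1`. [folklore] -/
theorem isCoord_nonneg (φ : Factor ι) (j : ι) : 0 ≤ φ.isCoord j := by
  cases φ with
  | coord c => by_cases h : c = j <;> simp [isCoord, h]
  | ext e => simp [isCoord]

/-- Two factors with the SAME coordinate pattern: both the coordinate `c`, or both external (a bookkeeping predicate
of the term-list data model). [cite: Tao2016AveragedNS, §4 (4.8); cell vocabulary, harvest/h2-tao-ladder rung1/KERNEL-CHEAP-REPLAY-SPEC.md §1 (term list)] -/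
def SameSkel : Factor ι → Factor ι → Prop
  | coord c, coord c' => c = c'
  | ext _, ext _ => True
  | _, _ => False

omit [Fintype ι] in
/-- Same skeleton ⇒ same coordinate indicator. [folklore] -/
theorem isCoord_eq_of_sameSkel {φ ψ : Factor ι} (h : SameSkel φ ψ) (j : ι) : φ.isCoord j = ψ.isCoord j := by
  cases φ with
  | coord c => cases ψ with
    | coord c' => cases (h : c = c'); rfl
    | ext _ => exact (h : False).elim
  | ext e => cases ψ with
    | coord _ => exact (h : False).elim
    | ext _ => rfl

end Factor

/-- A bilinear term: output component, coefficient, two factors. [cite: Tao2016AveragedNS, §4 (4.8); cell vocabulary, harvest/h2-tao-ladder rung1/KERNEL-CHEAP-REPLAY-SPEC.md §1] -/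
structure BTerm (ι : Type*) where
  /-- output component -/
  out : ι
  /-- coefficient (`α · λ^{…}`) -/
  coef : ℝ
  /-- first factor -/
  fa : Factor ι
  /-- second factor -/
  fb : Factor ι

/-- The coefficient of term `k` in the output component `i` (zero unless `out_k = i`). [folklore] -/
def BTerm.coefAt (τ : BTerm ι) (i : ι) : ℝ := if τ.out = i then τ.coef else 0

/-- **The term-list field**: component `i` is the sum of `coef · val fa · val fb` over the terms with output `i`.
[cite: Tao2016AveragedNS, §4 (4.8); cell vocabulary, harvest/h2-tao-ladder rung1/KERNEL-CHEAP-REPLAY-SPEC.md §1] -/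
def termField (T : κ → BTerm ι) (x : ι → ℝ) : ι → ℝ :=
  fun i => ∑ k, (T k).coefAt i * (T k).fa.val x * (T k).fb.val x

/-- **The Jacobian entry formula** `∂_j (termField T)_i (x)`. [folklore; cite: cell vocabulary, harvest/h2-tao-ladder rung1/KERNEL-CHEAP-REPLAY-SPEC.md §2 (d) (Ā from the terms)] -/
def jacEntry (T : κ → BTerm ι) (x : ι → ℝ) (i j : ι) : ℝ :=
  ∑ k, (T k).coefAt i * ((T k).fa.isCoord j * (T k).fb.val x + (T k).fa.val x * (T k).fb.isCoord j)

/-- The derivative of the term-list field as a continuous linear map (component `i`). [folklore] -/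
def termFieldDerivComp (T : κ → BTerm ι) (x : ι → ℝ) (i : ι) : (ι → ℝ) →L[ℝ] ℝ :=
  ∑ k, (T k).coefAt i • ((T k).fa.val x • (T k).fb.deriv + (T k).fb.val x • (T k).fa.deriv)

/-- The derivative of the term-list field as a continuous linear map. [folklore] -/
def termFieldDeriv (T : κ → BTerm ι) (x : ι → ℝ) : (ι → ℝ) →L[ℝ] (ι → ℝ) :=
  ContinuousLinearMap.pi fun i => termFieldDerivComp T x i

/-- **The term-list field is differentiable with the declared derivative.** [folklore] -/
theorem hasFDerivAt_termField (T : κ → BTerm ι) (x : ι → ℝ) :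
    HasFDerivAt (termField T) (termFieldDeriv T x) x := by
  rw [termFieldDeriv]
  refine hasFDerivAt_pi.2 fun i => ?_
  simp only [termField, termFieldDerivComp]
  refine HasFDerivAt.fun_sum fun k _ => ?_
  have ha := (T k).fa.hasFDerivAt_val x
  have hb := (T k).fb.hasFDerivAt_val x
  have h := (ha.fun_mul hb).const_mul ((T k).coefAt i)
  refine h.congr_of_eventuallyEq (Filter.Eventually.of_forall fun y => ?_)
  simp only [mul_assoc]

omit [Fintype ι] in
/-- **The entries of the derivative are `jacEntry`.** [folklore] -/
theorem termFieldDeriv_single (T : κ → BTerm ι) (x : ι → ℝ) (i j : ι) :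
    termFieldDeriv T x (Pi.single j 1) i = jacEntry T x i j := by
  simp only [termFieldDeriv, ContinuousLinearMap.pi_apply, termFieldDerivComp, jacEntry,
    FunLike.coe_sum, Finset.sum_apply, FunLike.coe_smul, Pi.smul_apply,
    add_apply, Factor.deriv_single, smul_eq_mul]
  exact Finset.sum_congr rfl fun k _ => by ring

/-- Within any set the term-list field has the declared derivative, with entries `jacEntry`. [folklore] -/
theorem hasFDerivWithinAt_termField (T : κ → BTerm ι) (s : Set (ι → ℝ)) (x : ι → ℝ) :
    HasFDerivWithinAt (termField T) (termFieldDeriv T x) s x :=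
  (hasFDerivAt_termField T x).hasFDerivWithinAt

/-! ### Closeness of the Jacobians of two term lists with the same skeleton -/

/-- Two term lists with the same skeleton: same outputs, coefficients and coordinate patterns (external values may
differ — two tail realisations, or tails vs tube centres; a bookkeeping predicate of the term-list data model).
[cite: Tao2016AveragedNS, §4 (4.8); cell vocabulary, harvest/h2-tao-ladder rung1/KERNEL-CHEAP-REPLAY-SPEC.md §1 (term list)] -/
def SameSkel (T T' : κ → BTerm ι) : Prop :=
  ∀ k, (T k).out = (T' k).out ∧ (T k).coef = (T' k).coef ∧
    Factor.SameSkel (T k).fa (T' k).fa ∧ Factor.SameSkel (T k).fb (T' k).fb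

omit [Fintype ι] in
/-- **Affine closeness of the Jacobian entries of two term lists with the same skeleton** at two states:
`|∂_j F_i(x) − ∂_j F'_i(x')| ≤ Σ_k [out_k = i] |coef_k| ([fa_k = j] |fb_k(x) − fb'_k(x')| + [fb_k = j] |fa_k(x) − fa'_k(x')|)`;
each factor difference is a coordinate difference `|x_c − x'_c|` or an external difference (≤ a tube radius) — the
`Bt + Σ_k L |x − x'|` of `StepSlopeData`. [folklore; cite: cell vocabulary, harvest/h2-tao-ladder rung1/KERNEL-CHEAP-REPLAY-SPEC.md §6 (iv)] -/
theorem abs_jacEntry_sub_le {T T' : κ → BTerm ι} (hT : SameSkel T T') (x x' : ι → ℝ) (i j : ι) :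
    |jacEntry T x i j - jacEntry T' x' i j| ≤
      ∑ k, |(T k).coefAt i| * ((T k).fa.isCoord j * |(T k).fb.val x - (T' k).fb.val x'| +
        |(T k).fa.val x - (T' k).fa.val x'| * (T k).fb.isCoord j) := by
  rw [jacEntry, jacEntry, ← Finset.sum_sub_distrib]
  refine (Finset.abs_sum_le_sum_abs _ _).trans (Finset.sum_le_sum fun k _ => ?_)
  obtain ⟨hout, hcoef, hfa, hfb⟩ := hT k
  have hca : (T' k).coefAt i = (T k).coefAt i := by simp [BTerm.coefAt, hout, hcoef]
  have hia : (T' k).fa.isCoord j = (T k).fa.isCoord j := (Factor.isCoord_eq_of_sameSkel hfa j).symm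
  have hib : (T' k).fb.isCoord j = (T k).fb.isCoord j := (Factor.isCoord_eq_of_sameSkel hfb j).symm
  rw [hca, hia, hib, ← mul_sub]
  have e : (T k).fa.isCoord j * (T k).fb.val x + (T k).fa.val x * (T k).fb.isCoord j -
      ((T k).fa.isCoord j * (T' k).fb.val x' + (T' k).fa.val x' * (T k).fb.isCoord j) =
      (T k).fa.isCoord j * ((T k).fb.val x - (T' k).fb.val x') +
        ((T k).fa.val x - (T' k).fa.val x') * (T k).fb.isCoord j := by ring
  rw [e, abs_mul]
  refine mul_le_mul_of_nonneg_left ?_ (abs_nonneg _)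
  refine (abs_add_le _ _).trans (add_le_add ?_ ?_)
  · rw [abs_mul, abs_of_nonneg ((T k).fa.isCoord_nonneg j)]
  · rw [abs_mul, abs_of_nonneg ((T k).fb.isCoord_nonneg j)]

omit [Fintype ι] in
/-- **Field deviation of two term lists with the same skeleton at the same state**: `|F_i(x) − F'_i(x)| ≤
Σ_k [out_k = i] |coef_k| (|fa_k(x) − fa'_k(x)| |fb_k(x)| + |fa'_k(x)| |fb_k(x) − fb'_k(x)|)` (only external factors
differ: tail realisation vs tube centre, or two realisations) — the `cb`, `cb B + ce E` of part XVII.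
[folklore; cite: cell vocabulary, harvest/h2-tao-ladder rung1/KERNEL-CHEAP-REPLAY-SPEC.md §2 (d) (inclusion half-widths)] -/
theorem abs_termField_sub_le {T T' : κ → BTerm ι} (hT : SameSkel T T') (x : ι → ℝ) (i : ι) :
    |termField T x i - termField T' x i| ≤
      ∑ k, |(T k).coefAt i| * (|(T k).fa.val x - (T' k).fa.val x| * |(T k).fb.val x| +
        |(T' k).fa.val x| * |(T k).fb.val x - (T' k).fb.val x|) := by
  rw [termField, termField, ← Finset.sum_sub_distrib]
  refine (Finset.abs_sum_le_sum_abs _ _).trans (Finset.sum_le_sum fun k _ => ?_)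
  obtain ⟨hout, hcoef, -, -⟩ := hT k
  have hca : (T' k).coefAt i = (T k).coefAt i := by simp [BTerm.coefAt, hout, hcoef]
  rw [hca]
  have e : (T k).coefAt i * (T k).fa.val x * (T k).fb.val x - (T k).coefAt i * (T' k).fa.val x * (T' k).fb.val x =
      (T k).coefAt i * (((T k).fa.val x - (T' k).fa.val x) * (T k).fb.val x +
        (T' k).fa.val x * ((T k).fb.val x - (T' k).fb.val x)) := by ring
  rw [e, abs_mul]
  refine mul_le_mul_of_nonneg_left ((abs_add_le _ _).trans (add_le_add ?_ ?_)) (abs_nonneg _)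
  · rw [abs_mul]
  · rw [abs_mul]

end DSSOneShift

end Summit.NavierStokesRegularity.NavierStokesRegularity.Theorems
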